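import Mathlib
import HarnessLib
import Summits.Ventures.LatticeQCDFlow.Scaling.AutoregressiveGaugeDominoReads
import Summits.Ventures.LatticeQCDFlow.Scaling.AutoregressiveGaugeCornerMoves
import Summits.Ventures.LatticeQCDFlow.Scaling.TorusPlaquetteGeometry

/-!
# LatticeQCDFlow / Scaling — two dimensions, `U(1)`: THE LINK CLOSING A DOMINO READS EACH OF THE FIVE
# OTHER BOUNDARY LINKS — INCLUDING TWO IT SHARES NEITHER A PLAQUETTE NOR A SITE WITH

HONEST FRAMING: exact (Metropolis-corrected) sampling algorithms for lattice gauge theory;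
figures of merit are autocorrelation/cost numbers at stated couplings and volumes; no
continuum-physics claim.

Venture `LatticeQCDFlow` (cell pub-lqcd), topic `Scaling`, FANOUT row 30 (lean-1, GEN-18) — OUR WORK on
THEORY-2.md §4 row C5, gauge case; sequel of `Scaling/AutoregressiveGaugeDominoReads`.  Same setting:
`(ℤ/L)²`, now `L ≥ 3`, `G = U(1)`, `F = e^{−β S_W}`, `β > 0`; domino `(x; 0,1) ∪ (x+e₀; 0,1)`, shared link
`(x+e₀, 1)` and everything off the domino integrated (`s`); boundary `e₁ = (x,0)` (current), `e₃ = (x+e₁,0)`,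
`e₄ = (x,1)`, `f₁ = (x+e₀,0)`, `f₂ = (x+2e₀,1)`, `f₃ = (x+e₀+e₁,0)`; `N = A_s F`, `M = A_{insert e₁ s} F`,
`R = N/M` the exact conditional of `U_{e₁}`.

* §1 Corner-by-corner gauge covariance of `R` ("blind to" = invariant under redrawing that link):
  `…_blind_e₁_of_blind_e₄` (corner `x`: both links leave `x`), `…_blind_e₄_of_blind_e₃` (corner `x+e₁`),
  `…_blind_f₁_of_blind_f₂` (corner `x+2e₀`), `…_blind_f₂_of_blind_f₃` (corner `x+2e₀+e₁`: both links
  arrive) — at each corner the two named boundary links are the only links outside `s` (`L ≥ 3`), so the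
  single-site rotation there moves only them (`coordAvg_eq_of_gaugeRelated_off`); and `…_not_blind_e₁`
  (the engine of the parent: `N` reads `e₁`, `M` does not), `…_blind_e₁_of_blind_f₁` (parent's corner
  `x+e₀`).
* §2 **`wilson2D_u1_closingLink_reads_each_boundaryLink`** — for every `L ≥ 3`, `β > 0`, `x` and EACH
  `b ∈ {e₃, e₄, f₁, f₂, f₃}` there are two configurations differing ONLY at `b` on which `R` differs.
  In particular `e₁` reads `f₂ = (x+2e₀, 1)` and `f₃ = (x+e₀+e₁, 0)`, links with which it shares neither
  a plaquette nor a site.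

READING (value-free, C5): with the interior of the domino integrated, the exact context of the closing
link is the WHOLE boundary loop, link by link — the gauge-reduced prediction "one holonomy class per
retained cycle" (GEN-16) is attained with every link of the cycle genuinely read.  NOT CLAIMED: non-abelian
groups, `d ≥ 3`, `L = 2` for the links other than `f₁`; any number of ours.  Elementary over the parents;
no `def`; nothing is cited as a fact; no `sorry`.
-/

noncomputable section

namespace Summit.Ventures.LatticeQCDFlow.Theory2.Autoregressive

open MeasureTheory Function Set
open Literature.MathematicalPhysics.QuantumFieldTheory Literature.MathematicalPhysics.QuantumLattice
open Summit.Ventures.LatticeQCDFlow.Exactness Summit.Ventures.LatticeQCDFlow.Theory2.HaarConv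
open Summit.Ventures.LatticeQCDFlow.Theory2.Lattice.TorusGeom (add_single_add_single_ne_self)
open scoped ENNReal

variable {L : ℕ} [NeZero L]

/-! ## §1 Geometry of the domino for `L ≥ 3` -/

omit [NeZero L] in
/-- `(z + e_i) + e_j ≠ z` on `(ℤ/L)²` for `L ≥ 3` (for `i = j` this is `2e_i ≠ 0`). [ours] -/
theorem shift_shift_ne (hL : 3 ≤ L) (z : Site 2 L) (i j : Fin 2) : (z.shift i).shift j ≠ z :=
  add_single_add_single_ne_self hL z i j

omit [NeZero L] in
/-- Shifts commute. [ours] -/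
theorem shift_comm (z : Site 2 L) (i j : Fin 2) : (z.shift i).shift j = (z.shift j).shift i := by
  simp only [Site.shift]; exact add_right_comm _ _ _

omit [NeZero L] in
/-- `z + 2e₀ + e₁ ≠ z` (`L ≥ 2`: the `e₁`-component is `1`). [ours] -/
theorem shift_zero_zero_one_ne (hL : 2 ≤ L) (z : Site 2 L) : ((z.shift 0).shift 0).shift 1 ≠ z := by
  haveI : Fact (1 < L) := ⟨hL⟩
  intro h
  have h1 := congrFun h 1
  simp [Site.shift] at h1

omit [NeZero L] in
/-- `z + e₁ ≠ z + 2e₀` (`L ≥ 2`). [ours] -/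
theorem shift_one_ne_shift_zero_zero (hL : 2 ≤ L) (z : Site 2 L) : z.shift 1 ≠ (z.shift 0).shift 0 := by
  haveI : Fact (1 < L) := ⟨hL⟩
  intro h
  have h1 := congrFun h 1
  simp [Site.shift] at h1

/-! ## §2 The closing link reads each of the five other boundary links -/

/-- **THE LINK CLOSING A DOMINO READS EACH OF THE FIVE OTHER BOUNDARY LINKS** (2-d `U(1)`, Wilson
action, every `L ≥ 3`, `β > 0`).  With `s` the links off the boundary of the domino
`(x; 0,1) ∪ (x+e₀; 0,1)`, `e₁ = (x, 0)`, `N = A_s e^{−βS_W}`, `M = A_{insert e₁ s} e^{−βS_W}`: for EACH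
boundary link `b ≠ e₁` — `(x+e₁, 0)`, `(x, 1)`, `(x+e₀, 0)`, `(x+2e₀, 1)`, `(x+e₀+e₁, 0)` — there are two
configurations differing ONLY at `b` on which the exact conditional `N/M` of `U_{e₁}` differs. [ours] -/
theorem wilson2D_u1_closingLink_reads_each_boundaryLink (hL : 3 ≤ L) {β : ℝ} (hβ : 0 < β) (x : Site 2 L)
    (b : Edge 2 L)
    (hb : b ∈ ({(x.shift 1, (0 : Fin 2)), (x, (1 : Fin 2)), (x.shift 0, (0 : Fin 2)),
      ((x.shift 0).shift 0, (1 : Fin 2)), ((x.shift 0).shift 1, (0 : Fin 2))} : Finset (Edge 2 L))) :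
    ∃ U U' : GaugeConfig 2 L Circle,
      (∀ e : Edge 2 L, e ≠ b → U e = U' e) ∧
      coordAvg (haarProbability Circle)
          (Finset.univ \ {(x, (0 : Fin 2)), (x.shift 1, (0 : Fin 2)), (x, (1 : Fin 2)),
            (x.shift 0, (0 : Fin 2)), ((x.shift 0).shift 0, (1 : Fin 2)), ((x.shift 0).shift 1, (0 : Fin 2))})
          (fun V : GaugeConfig 2 L Circle => Real.exp (-β * wilsonAction u1Rep V)) U /
        coordAvg (haarProbability Circle)
          (insert (x, (0 : Fin 2))
            (Finset.univ \ {(x, (0 : Fin 2)), (x.shift 1, (0 : Fin 2)), (x, (1 : Fin 2)),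
              (x.shift 0, (0 : Fin 2)), ((x.shift 0).shift 0, (1 : Fin 2)), ((x.shift 0).shift 1, (0 : Fin 2))}))
          (fun V : GaugeConfig 2 L Circle => Real.exp (-β * wilsonAction u1Rep V)) U ≠
      coordAvg (haarProbability Circle)
          (Finset.univ \ {(x, (0 : Fin 2)), (x.shift 1, (0 : Fin 2)), (x, (1 : Fin 2)),
            (x.shift 0, (0 : Fin 2)), ((x.shift 0).shift 0, (1 : Fin 2)), ((x.shift 0).shift 1, (0 : Fin 2))})
          (fun V : GaugeConfig 2 L Circle => Real.exp (-β * wilsonAction u1Rep V)) U' /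
        coordAvg (haarProbability Circle)
          (insert (x, (0 : Fin 2))
            (Finset.univ \ {(x, (0 : Fin 2)), (x.shift 1, (0 : Fin 2)), (x, (1 : Fin 2)),
              (x.shift 0, (0 : Fin 2)), ((x.shift 0).shift 0, (1 : Fin 2)), ((x.shift 0).shift 1, (0 : Fin 2))}))
          (fun V : GaugeConfig 2 L Circle => Real.exp (-β * wilsonAction u1Rep V)) U' := by
  classical
  have hL2 : 2 ≤ L := le_trans (by norm_num) hL
  -- names
  set μ := haarProbability Circle with hμ
  set e₁ : Edge 2 L := (x, (0 : Fin 2)) with he₁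
  set e₃ : Edge 2 L := (x.shift 1, (0 : Fin 2)) with he₃
  set e₄ : Edge 2 L := (x, (1 : Fin 2)) with he₄
  set f₁ : Edge 2 L := (x.shift 0, (0 : Fin 2)) with hf₁
  set f₂ : Edge 2 L := ((x.shift 0).shift 0, (1 : Fin 2)) with hf₂
  set f₃ : Edge 2 L := ((x.shift 0).shift 1, (0 : Fin 2)) with hf₃
  set s : Finset (Edge 2 L) := Finset.univ \ {e₁, e₃, e₄, f₁, f₂, f₃} with hs
  set F : GaugeConfig 2 L Circle → ℝ := fun V => Real.exp (-β * wilsonAction u1Rep V) with hF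
  set N := coordAvg μ s F with hN
  set M := coordAvg μ (insert e₁ s) F with hM
  -- geometry (`L ≥ 3`)
  have h01 : (0 : Fin 2) ≠ 1 := by decide
  have h10 : ∀ {a c : Site 2 L}, ((a, (1 : Fin 2)) : Edge 2 L) ≠ (c, 0) := fun h =>
    h01 (congrArg Prod.snd h).symm
  have hS1 : ∀ (z : Site 2 L) (i : Fin 2), z.shift i ≠ z := fun z i => site_shift_ne hL2 z i
  have hS2 : ∀ (z : Site 2 L) (i j : Fin 2), (z.shift i).shift j ≠ z := fun z i j => shift_shift_ne hL z i j
  have hS3 : ∀ z : Site 2 L, ((z.shift 0).shift 0).shift 1 ≠ z := fun z => shift_zero_zero_one_ne hL2 z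
  have hS4 : ∀ z : Site 2 L, z.shift 1 ≠ (z.shift 0).shift 0 := fun z => shift_one_ne_shift_zero_zero hL2 z
  have hS5 : ∀ z : Site 2 L, z.shift 1 ≠ z.shift 0 := fun z => shift_one_ne_shift_zero hL2 z
  have hinj : ∀ (i : Fin 2) {a c : Site 2 L}, a.shift i = c.shift i → a = c := fun i a c h =>
    site_shift_injective (L := L) i h
  have hmem_s : ∀ e : Edge 2 L, e ∈ s ↔ e ≠ e₁ ∧ e ≠ e₃ ∧ e ≠ e₄ ∧ e ≠ f₁ ∧ e ≠ f₂ ∧ e ≠ f₃ := by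
    intro e; simp [hs]
  -- weight facts
  obtain ⟨hFm, hFb, hFlo⟩ := wilsonWeight_two_u1_props (L := L) β hβ.le
  have hFgi : IsGaugeInvariant F := isGaugeInvariant_wilsonWeightFun u1Rep β
  have hF1 : ∀ V, F V ≤ 1 := fun V => (le_abs_self _).trans (hFb V)
  have hMb : ∀ U, Real.exp (-(2 * β * (L : ℝ) ^ 2)) ≤ M U ∧ M U ≤ 1 := fun U =>
    coordAvg_mem_Icc μ (insert e₁ s) hFm hFlo hF1 U
  have hMpos : ∀ U, 0 < M U := fun U => lt_of_lt_of_le (Real.exp_pos _) (hMb U).1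
  have hMe₁ : ∀ (U : GaugeConfig 2 L Circle) (v : Circle), M (update U e₁ v) = M U := by
    intro U v
    refine coordAvg_congr_off (insert e₁ s) F fun e he => ?_
    have : e ≠ e₁ := fun h => he (h ▸ Finset.mem_insert_self e₁ s)
    exact update_of_ne this _ _
  -- Step 0: `R = N/M` is not blind to `e₁` (the engine of the parent)
  have hR1 : ¬ ∀ (U : GaugeConfig 2 L Circle) (v : Circle),
      N (update U e₁ v) / M (update U e₁ v) = N U / M U := by
    intro hb
    obtain ⟨U, v, hUv⟩ := wilson2D_u1_dominoMarginal_reads_closingLink hL2 hβ x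
    apply hUv
    have h := hb U v
    rw [hMe₁] at h
    exact (div_left_inj' (hMpos U).ne').1 h
  -- Step 1: corner `x` (both `e₁`, `e₄` leave): blind `e₁` ↔ blind `e₄`
  have hstar0 : ∀ e : Edge 2 L, e.1 = x ∨ e.1.shift e.2 = x → e ≠ e₁ → e ≠ e₄ → e ∈ s := by
    rintro ⟨z, k⟩ he hn1 hn2
    rw [hmem_s]
    obtain rfl | rfl : k = 0 ∨ k = 1 := by fin_cases k <;> simp
    · rcases he with h | h
      · exact (hn1 (Prod.ext h rfl)).elim
      · simp only at h
        refine ⟨fun h' => ?_, fun h' => ?_, h10.symm, fun h' => ?_, h10.symm, fun h' => ?_⟩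
        · have hz : z = x := congrArg Prod.fst h'
          subst hz; exact hS1 _ 0 h
        · have hz : z = x.shift 1 := congrArg Prod.fst h'
          subst hz; exact hS2 x 1 0 h
        · have hz : z = x.shift 0 := congrArg Prod.fst h'
          subst hz; exact hS2 x 0 0 h
        · have hz : z = (x.shift 0).shift 1 := congrArg Prod.fst h'
          subst hz
          rw [shift_comm (x.shift 0) 1 0] at h
          exact hS3 x h
    · rcases he with h | h
      · exact (hn2 (Prod.ext h rfl)).elim
      · simp only at h
        refine ⟨h10, h10, fun h' => ?_, h10, fun h' => ?_, h10⟩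
        · have hz : z = x := congrArg Prod.fst h'
          subst hz; exact hS1 _ 1 h
        · have hz : z = (x.shift 0).shift 0 := congrArg Prod.fst h'
          subst hz; exact hS3 x h
  have hC0 := arConditional_blind_iff_of_cornerOut (G := Circle) (s := s) hFgi e₁ (y := x) (ℓ₁ := e₁)
    (ℓ₂ := e₄) (fun h => h01 (congrArg Prod.snd h)) rfl (hS1 x 0) rfl (hS1 x 1) hstar0
  -- Step 2: corner `x + e₁` (`e₄` arrives, `e₃` leaves): blind `e₄` ↔ blind `e₃`
  have hstar1 : ∀ e : Edge 2 L, e.1 = x.shift 1 ∨ e.1.shift e.2 = x.shift 1 → e ≠ e₄ → e ≠ e₃ → e ∈ s := by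
    rintro ⟨z, k⟩ he hn1 hn2
    rw [hmem_s]
    obtain rfl | rfl : k = 0 ∨ k = 1 := by fin_cases k <;> simp
    · rcases he with h | h
      · exact (hn2 (Prod.ext h rfl)).elim
      · simp only at h
        refine ⟨fun h' => ?_, fun h' => ?_, h10.symm, fun h' => ?_, h10.symm, fun h' => ?_⟩
        · have hz : z = x := congrArg Prod.fst h'
          subst hz; exact hS5 _ h.symm
        · have hz : z = x.shift 1 := congrArg Prod.fst h'
          subst hz; exact hS1 _ 0 h
        · have hz : z = x.shift 0 := congrArg Prod.fst h'
          subst hz; exact hS4 x h.symm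
        · have hz : z = (x.shift 0).shift 1 := congrArg Prod.fst h'
          subst hz
          rw [shift_comm x 0 1] at h
          exact hS2 (x.shift 1) 0 0 h
    · rcases he with h | h
      · simp only at h
        subst h
        refine ⟨h10, h10, fun h' => hS1 x 1 (congrArg Prod.fst h'), h10, fun h' => hS4 x (congrArg Prod.fst h'), h10⟩
      · exact (hn1 (Prod.ext (hinj 1 h) rfl)).elim
  have hC1 := arConditional_blind_iff_of_cornerThrough (G := Circle) (s := s) hFgi e₁ (y := x.shift 1)
    (ℓ₁ := e₄) (ℓ₂ := e₃) h10 rfl (hS1 x 1).symm rfl (hS1 (x.shift 1) 0) hstar1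
  -- Step 3: corner `x + e₀` (`e₁` arrives, `f₁` leaves): blind `e₁` ↔ blind `f₁`
  have hstar2 : ∀ e : Edge 2 L, e.1 = x.shift 0 ∨ e.1.shift e.2 = x.shift 0 → e ≠ e₁ → e ≠ f₁ → e ∈ s := by
    rintro ⟨z, k⟩ he hn1 hn2
    rw [hmem_s]
    obtain rfl | rfl : k = 0 ∨ k = 1 := by fin_cases k <;> simp
    · rcases he with h | h
      · exact (hn2 (Prod.ext h rfl)).elim
      · exact (hn1 (Prod.ext (hinj 0 h) rfl)).elim
    · rcases he with h | h
      · simp only at h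
        subst h
        exact ⟨h10, h10, fun h => hS1 x 0 (congrArg Prod.fst h), h10,
          fun h => (hS1 (x.shift 0) 0) (congrArg Prod.fst h).symm, h10⟩
      · simp only at h
        refine ⟨h10, h10, fun h' => ?_, h10, fun h' => ?_, h10⟩
        · have hz : z = x := congrArg Prod.fst h'
          subst hz; exact hS5 _ h
        · have hz : z = (x.shift 0).shift 0 := congrArg Prod.fst h'
          subst hz; exact shift_zero_shift_one_ne hL2 (x.shift 0) h
  have hC2 := arConditional_blind_iff_of_cornerThrough (G := Circle) (s := s) hFgi e₁ (y := x.shift 0)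
    (ℓ₁ := e₁) (ℓ₂ := f₁) (fun h => (hS1 x 0).symm (congrArg Prod.fst h)) rfl (hS1 x 0).symm rfl
    (hS1 (x.shift 0) 0) hstar2
  -- Step 4: corner `x + 2e₀` (`f₁` arrives, `f₂` leaves): blind `f₁` ↔ blind `f₂`
  have hstar3 : ∀ e : Edge 2 L, e.1 = (x.shift 0).shift 0 ∨ e.1.shift e.2 = (x.shift 0).shift 0 →
      e ≠ f₁ → e ≠ f₂ → e ∈ s := by
    rintro ⟨z, k⟩ he hn1 hn2
    rw [hmem_s]
    obtain rfl | rfl : k = 0 ∨ k = 1 := by fin_cases k <;> simp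
    · rcases he with h | h
      · simp only at h
        subst h
        refine ⟨fun h' => hS2 x 0 0 (congrArg Prod.fst h'), fun h' => hS4 x (congrArg Prod.fst h').symm,
          h10.symm, fun h' => hS1 (x.shift 0) 0 (congrArg Prod.fst h'), h10.symm, fun h' => ?_⟩
        exact hS5 (x.shift 0) (congrArg Prod.fst h').symm
      · exact (hn1 (Prod.ext (hinj 0 h) rfl)).elim
    · rcases he with h | h
      · exact (hn2 (Prod.ext h rfl)).elim
      · simp only at h
        refine ⟨h10, h10, fun h' => ?_, h10, fun h' => ?_, h10⟩
        · have hz : z = x := congrArg Prod.fst h'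
          subst hz; exact hS4 _ h
        · have hz : z = (x.shift 0).shift 0 := congrArg Prod.fst h'
          subst hz; exact hS1 _ 1 h
  have hC3 := arConditional_blind_iff_of_cornerThrough (G := Circle) (s := s) hFgi e₁
    (y := (x.shift 0).shift 0) (ℓ₁ := f₁) (ℓ₂ := f₂) h10.symm rfl (hS1 (x.shift 0) 0).symm rfl
    (hS1 ((x.shift 0).shift 0) 1) hstar3
  -- Step 5: corner `x + 2e₀ + e₁` (`f₂`, `f₃` both arrive): blind `f₂` ↔ blind `f₃`
  have hstar4 : ∀ e : Edge 2 L, e.1 = ((x.shift 0).shift 0).shift 1 ∨ e.1.shift e.2 = ((x.shift 0).shift 0).shift 1 →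
      e ≠ f₂ → e ≠ f₃ → e ∈ s := by
    rintro ⟨z, k⟩ he hn1 hn2
    rw [hmem_s]
    obtain rfl | rfl : k = 0 ∨ k = 1 := by fin_cases k <;> simp
    · rcases he with h | h
      · simp only at h
        subst h
        refine ⟨fun h' => hS3 x (congrArg Prod.fst h'), fun h' => ?_, h10.symm, fun h' => ?_, h10.symm,
          fun h' => ?_⟩
        · have h'' : ((x.shift 0).shift 0).shift 1 = x.shift 1 := congrArg Prod.fst h'
          rw [shift_comm (x.shift 0) 0 1, shift_comm x 0 1] at h''
          exact hS2 (x.shift 1) 0 0 h''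
        · have h'' : ((x.shift 0).shift 0).shift 1 = x.shift 0 := congrArg Prod.fst h'
          rw [shift_comm (x.shift 0) 0 1] at h''
          exact hS2 (x.shift 0) 1 0 h''
        · have h'' : ((x.shift 0).shift 0).shift 1 = (x.shift 0).shift 1 := congrArg Prod.fst h'
          rw [shift_comm (x.shift 0) 0 1] at h''
          exact hS1 ((x.shift 0).shift 1) 0 h''
      · -- arriving with direction 0: `z.shift 0 = y`, i.e. `z = (x.shift 0).shift 1`: that is `f₃`
        have hz : z = (x.shift 0).shift 1 := hinj 0 (h.trans (shift_comm (x.shift 0) 0 1))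
        exact (hn2 (Prod.ext hz rfl)).elim
    · rcases he with h | h
      · simp only at h
        subst h
        refine ⟨h10, h10, fun h' => hS3 x (congrArg Prod.fst h'), h10, fun h' => ?_, h10⟩
        exact hS1 ((x.shift 0).shift 0) 1 (congrArg Prod.fst h')
      · exact (hn1 (Prod.ext (hinj 1 h) rfl)).elim
  have hC4 := arConditional_blind_iff_of_cornerIn (G := Circle) (s := s) hFgi e₁
    (y := ((x.shift 0).shift 0).shift 1) (ℓ₁ := f₂) (ℓ₂ := f₃) h10 rfl (hS1 ((x.shift 0).shift 0) 1).symm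
    (by show ((x.shift 0).shift 1).shift 0 = ((x.shift 0).shift 0).shift 1; exact shift_comm (x.shift 0) 1 0)
    (fun h => hS1 (x.shift 0) 0 (hinj 1 h).symm) hstar4
  -- Step 6: none of the five is blind
  have hn4 : ¬ _ := fun h => hR1 (hC0.2 h)
  have hn3 : ¬ _ := fun h => hn4 (hC1.2 h)
  have hm1 : ¬ _ := fun h => hR1 (hC2.2 h)
  have hm2 : ¬ _ := fun h => hm1 (hC3.2 h)
  have hm3 : ¬ _ := fun h => hm2 (hC4.2 h)
  -- Step 7: not blind ⇒ two configurations differing only at `b`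
  have key : ∀ b' : Edge 2 L, (¬ ∀ (U : GaugeConfig 2 L Circle) (v : Circle),
      N (update U b' v) / M (update U b' v) = N U / M U) →
      ∃ U U' : GaugeConfig 2 L Circle, (∀ e : Edge 2 L, e ≠ b' → U e = U' e) ∧ N U / M U ≠ N U' / M U' := by
    intro b' hb'
    push Not at hb'
    obtain ⟨U, v, hUv⟩ := hb'
    exact ⟨U, update U b' v, fun e he => (update_of_ne he _ _).symm, fun h => hUv h.symm⟩
  simp only [Finset.mem_insert, Finset.mem_singleton] at hb
  rcases hb with rfl | rfl | rfl | rfl | rfl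
  · exact key _ hn3
  · exact key _ hn4
  · exact key _ hm1
  · exact key _ hm2
  · exact key _ hm3
end Summit.Ventures.LatticeQCDFlow.Theory2.Autoregressive

end
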